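import Literature.AlgebraicGeometry.Hyperkaehler.K3HilbertTypeLefschetzStandard
import Literature.AlgebraicGeometry.Hyperkaehler.GeneralizedKummerTypeLefschetzStandard
import Literature.AlgebraicGeometry.HodgeTheory.HomologicalNumericalEquivalenceComplex
import HarnessLib

/-!
# `D(X)` for projective hyper-Kähler varieties of `K3^[n]`-type (Charles–Markman) and of `Kumⁿ`-type, `n + 1` prime (Foster), modulo Voisin II Prop. 9.20

Layer `Literature/AlgebraicGeometry/Hyperkaehler`; lane `lit-hodgefound`. THEOREMS ONLY (no definition,
no named fact; D-0026). Kernel consequences of the two NAMED FACTS of this layer recording the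
Lefschetz standard conjecture `B` in the tree's `*_L`-form,
`CharlesMarkman2013_lefschetzStandard_K3HilbertType` (F. Charles, E. Markman, Compos. Math. 149 (2013),
Thm. 1.1: "The Lefschetz standard conjecture holds for every smooth projective variety of
`K3^[n]`-type"; Cor. 1.2: "The standard conjectures hold for any smooth projective variety of
`K3^[n]`-type") and `Foster2024_lefschetzStandard_kummerType_prime` (J. Foster, Eur. J. Math. 10
(2024), Cor. 2: `B` for `Kumⁿ`-type when `n + 1` is prime), combined with the tree's theorem
`HodgeTheory.eq_zero_of_mem_algebraicClasses_of_forall_pairing_eq_zero_of_standardConjectureBStar`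
(`B(X)` + Prop. 9.20 on `X × X` `⟹ D(X)` over `ℂ`, Murre 2004 §4.2.1.4 (1): "`B(X) + Hdg(X) ⟹ D(X)`",
`Hdg(X)` being a theorem over `ℂ`) and its complex readings (`HomologicalNumericalEquivalenceComplex`):
the `D`-part of Charles–Markman's Corollary 1.2, resp. of Foster's Corollary 2 with Kleiman, for the
Betti carriers — homological and numerical equivalence agree, rationally and for complex combinations of
algebraic classes, the intersection pairings `Nᵖ(X) × N^q(X) → ℂ` are non-degenerate and
`dim_ℂ Nᵖ(X) = dim_ℂ N^q(X)` (`2p + 2q = 4n`) — MODULO the named facts (hypotheses `h`) and the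
multiplicativity of algebraic classes on `X ⊗ X` (Voisin II Prop. 9.20, hypothesis `hcup`; the
tree's named fact `HodgeTheory.Voisin2003_cupProduct_algebraicClasses` in the `…_of_cupProduct_algebraicClasses`
forms).

## References

* [CharlesMarkman2013] F. Charles, E. Markman, The standard conjectures for holomorphic symplectic
  varieties deformation equivalent to Hilbert schemes of K3 surfaces, Compos. Math. 149 (2013), Thm. 1.1,
  Cor. 1.2 (arXiv:1009.0413, read: `paper:arxiv-1009.0413`).
* [Foster2024] J. Foster, The Lefschetz standard conjectures for IHSMs of generalized Kummer deformation
  type in certain degrees, Eur. J. Math. 10 (2024), Thm. 1, Cor. 2 (arXiv:2303.14327).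
* [Murre2004LecturesMotives] J. P. Murre, Lectures on motives (2004), §4.2.1.4 (1).
* [Kleiman1968AlgebraicCycles] S. L. Kleiman, Algebraic cycles and the Weil conjectures (1968), §3.
* [VoisinHodgeII2003] C. Voisin, Hodge Theory and Complex Algebraic Geometry II (2003), §9.2.4 Prop. 9.20.
-/

noncomputable section

open CategoryTheory AlgebraicGeometry MonoidalCategory
open Literature.AlgebraicTopology.SingularHomology
open Literature.AlgebraicGeometry.HodgeTheory
open Literature.AlgebraicGeometry.Motives (IsSmoothProjective)

namespace Literature.AlgebraicGeometry.Hyperkaehler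

variable {n : ℕ} {X : Motives.SchemeOver ℂ}

/-! ### `K3^[n]`-type (Charles–Markman 2013, Cor. 1.2, the `D`-part) -/

namespace CharlesMarkman2013_lefschetzStandard_K3HilbertType

/-- **`D(X)` with `ℚ`-coefficients for `X` smooth projective of `K3^[n]`-type** (dimension `2n`),
modulo Charles–Markman's Thm. 1.1 (`h`) and Prop. 9.20 on `X ⊗ X` (`hcup`): for `2p + 2q = 4n`, ANY
orientation `μ`, every `x ∈ Nᵖ(X)_ℚ` with `⟨x ⌣ z, [X(ℂ)]_μ ⊗ 1_ℚ⟩ = 0` for all `z ∈ N^q(X)_ℚ` is `0`.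
[cite: CharlesMarkman2013, Thm. 1.1 and Cor. 1.2 (§1)] [cite: Murre2004LecturesMotives, §4.2.1.4 (1)] -/
theorem eq_zero_of_mem_algebraicClasses_of_forall_pairing_eq_zero
    (h : CharlesMarkman2013_lefschetzStandard_K3HilbertType) (hX : IsSmoothProjective (2 * n) X)
    (hK : IsOfK3HilbertType n X)
    (hcup : ∀ (a b : ℕ) (x : complexBetti (X ⊗ X) (2 * a)) (y : complexBetti (X ⊗ X) (2 * b)),
      x ∈ algebraicClasses (X ⊗ X) a → y ∈ algebraicClasses (X ⊗ X) b →
        cupProduct (two_mul_add_two_mul a b) x y ∈ algebraicClasses (X ⊗ X) (a + b))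
    {p q : ℕ} (hpq : 2 * p + 2 * q = 2 * (2 * n))
    (μ : HomologicalOrientation ℤ (Motives.ComplexPoints X) (2 * (2 * n)))
    {x : singularCohomology ℚ ℚ (Motives.ComplexPoints X) (2 * p)}
    (hx : ofRatClass (Motives.ComplexPoints X) (2 * p) x ∈ algebraicClasses X p)
    (hnum : ∀ z : singularCohomology ℚ ℚ (Motives.ComplexPoints X) (2 * q),
      ofRatClass (Motives.ComplexPoints X) (2 * q) z ∈ algebraicClasses X q →
        kroneckerPairing ℚ ℚ (Motives.ComplexPoints X) (2 * (2 * n)) (cupProduct hpq x z)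
          (singularHomology.coeffChange (Motives.ComplexPoints X)
            (algebraMap ℤ ℚ : ℤ →+* ℚ).toAddMonoidHom (2 * (2 * n)) μ.fundamentalClass) = 0) :
    x = 0 :=
  HodgeTheory.eq_zero_of_mem_algebraicClasses_of_forall_pairing_eq_zero_of_standardConjectureBStar hX
    (h n hX hK) hcup hpq μ hx hnum

/-- `D(X) ⊗ ℂ` for `K3^[n]`-type, modulo Charles–Markman and Prop. 9.20: a complex class `x ∈ Nᵖ(X)` with
`⟨x ⌣ z, [X(ℂ)]_μ ⊗ 1_ℂ⟩ = 0` for all `z ∈ N^q(X)` (`2p + 2q = 4n`) is `0`.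
[cite: CharlesMarkman2013, Cor. 1.2 (§1)] [cite: Murre2004LecturesMotives, §4.2.1.4 (1)] -/
theorem eq_zero_of_mem_algebraicClasses_of_forall_pairing_complex_eq_zero
    (h : CharlesMarkman2013_lefschetzStandard_K3HilbertType) (hX : IsSmoothProjective (2 * n) X)
    (hK : IsOfK3HilbertType n X)
    (hcup : ∀ (a b : ℕ) (x : complexBetti (X ⊗ X) (2 * a)) (y : complexBetti (X ⊗ X) (2 * b)),
      x ∈ algebraicClasses (X ⊗ X) a → y ∈ algebraicClasses (X ⊗ X) b →
        cupProduct (two_mul_add_two_mul a b) x y ∈ algebraicClasses (X ⊗ X) (a + b))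
    {p q : ℕ} (hpq : 2 * p + 2 * q = 2 * (2 * n))
    (μ : HomologicalOrientation ℤ (Motives.ComplexPoints X) (2 * (2 * n)))
    {x : complexBetti X (2 * p)} (hx : x ∈ algebraicClasses X p)
    (hnum : ∀ z ∈ algebraicClasses X q,
      kroneckerPairing ℂ ℂ (Motives.ComplexPoints X) (2 * (2 * n)) (cupProduct hpq x z)
        (singularHomology.coeffChange (Motives.ComplexPoints X)
          (algebraMap ℤ ℂ : ℤ →+* ℂ).toAddMonoidHom (2 * (2 * n)) μ.fundamentalClass) = 0) :
    x = 0 :=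
  HodgeTheory.eq_zero_of_mem_algebraicClasses_of_forall_pairing_complex_eq_zero_of_standardConjectureBStar
    hX (h n hX hK) hcup hpq μ hx hnum

/-- `D(X) ⊗ ℂ` for `K3^[n]`-type, orientation-free: `x ∈ Nᵖ(X)` with `x ⌣ z = 0` for all `z ∈ N^q(X)`
(`2p + 2q = 4n`) is `0`, modulo Charles–Markman and Prop. 9.20. [cite: CharlesMarkman2013, Cor. 1.2 (§1)] -/
theorem eq_zero_of_mem_algebraicClasses_of_forall_cupProduct_eq_zero
    (h : CharlesMarkman2013_lefschetzStandard_K3HilbertType) (hX : IsSmoothProjective (2 * n) X)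
    (hK : IsOfK3HilbertType n X)
    (hcup : ∀ (a b : ℕ) (x : complexBetti (X ⊗ X) (2 * a)) (y : complexBetti (X ⊗ X) (2 * b)),
      x ∈ algebraicClasses (X ⊗ X) a → y ∈ algebraicClasses (X ⊗ X) b →
        cupProduct (two_mul_add_two_mul a b) x y ∈ algebraicClasses (X ⊗ X) (a + b))
    {p q : ℕ} (hpq : 2 * p + 2 * q = 2 * (2 * n)) {x : complexBetti X (2 * p)}
    (hx : x ∈ algebraicClasses X p) (hcup0 : ∀ z ∈ algebraicClasses X q, cupProduct hpq x z = 0) :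
    x = 0 :=
  HodgeTheory.eq_zero_of_mem_algebraicClasses_of_forall_cupProduct_eq_zero_of_standardConjectureBStar hX
    (h n hX hK) hcup hpq hx hcup0

/-- For `K3^[n]`-type, modulo Charles–Markman and Prop. 9.20: the complex intersection pairing
`Nᵖ(X) × N^q(X) → ℂ` (`2p + 2q = 4n`, any `μ`) is non-degenerate on both sides.
[cite: CharlesMarkman2013, Cor. 1.2 (§1)] [cite: Kleiman1968AlgebraicCycles, §3] -/
theorem pairing_algebraicClasses_complex_nondegenerate
    (h : CharlesMarkman2013_lefschetzStandard_K3HilbertType) (hX : IsSmoothProjective (2 * n) X)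
    (hK : IsOfK3HilbertType n X)
    (hcup : ∀ (a b : ℕ) (x : complexBetti (X ⊗ X) (2 * a)) (y : complexBetti (X ⊗ X) (2 * b)),
      x ∈ algebraicClasses (X ⊗ X) a → y ∈ algebraicClasses (X ⊗ X) b →
        cupProduct (two_mul_add_two_mul a b) x y ∈ algebraicClasses (X ⊗ X) (a + b))
    {p q : ℕ} (hpq : 2 * p + 2 * q = 2 * (2 * n))
    (μ : HomologicalOrientation ℤ (Motives.ComplexPoints X) (2 * (2 * n))) :
    (((cupProduct (R := ℂ) (X := Motives.ComplexPoints X) hpq).compr₂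
        ((kroneckerPairing ℂ ℂ (Motives.ComplexPoints X) (2 * (2 * n))).flip
          (singularHomology.coeffChange (Motives.ComplexPoints X)
            (algebraMap ℤ ℂ : ℤ →+* ℂ).toAddMonoidHom (2 * (2 * n)) μ.fundamentalClass))).domRestrict₁₂
      (algebraicClasses X p) (algebraicClasses X q)).Nondegenerate :=
  HodgeTheory.pairing_algebraicClasses_complex_nondegenerate_of_standardConjectureBStar hX (h n hX hK)
    hcup hpq μ

/-- For `K3^[n]`-type, modulo Charles–Markman and Prop. 9.20: `dim_ℂ Nᵖ(X) = dim_ℂ N^q(X)` for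
`2p + 2q = 4n` (Kleiman's `A(X, L)`). [cite: CharlesMarkman2013, Cor. 1.2 (§1)] [cite: Murre2004LecturesMotives, §4.2.1.2 Rem. 2 (b)] -/
theorem finrank_algebraicClasses_complex_eq
    (h : CharlesMarkman2013_lefschetzStandard_K3HilbertType) (hX : IsSmoothProjective (2 * n) X)
    (hK : IsOfK3HilbertType n X)
    (hcup : ∀ (a b : ℕ) (x : complexBetti (X ⊗ X) (2 * a)) (y : complexBetti (X ⊗ X) (2 * b)),
      x ∈ algebraicClasses (X ⊗ X) a → y ∈ algebraicClasses (X ⊗ X) b →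
        cupProduct (two_mul_add_two_mul a b) x y ∈ algebraicClasses (X ⊗ X) (a + b))
    {p q : ℕ} (hpq : 2 * p + 2 * q = 2 * (2 * n)) :
    Module.finrank ℂ (algebraicClasses X p) = Module.finrank ℂ (algebraicClasses X q) :=
  HodgeTheory.finrank_algebraicClasses_complex_eq_of_standardConjectureBStar hX (h n hX hK) hcup hpq

/-- `D(X)` with `ℚ`-coefficients for `K3^[n]`-type with Prop. 9.20 in the packaged form of the named
fact `HodgeTheory.Voisin2003_cupProduct_algebraicClasses`. [cite: CharlesMarkman2013, Cor. 1.2 (§1)]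
[cite: VoisinHodgeII2003, §9.2.4 Prop. 9.20] -/
theorem eq_zero_of_mem_algebraicClasses_of_forall_pairing_eq_zero_of_cupProduct_algebraicClasses
    (h : CharlesMarkman2013_lefschetzStandard_K3HilbertType) (hV : Voisin2003_cupProduct_algebraicClasses)
    (hX : IsSmoothProjective (2 * n) X) (hK : IsOfK3HilbertType n X) {p q : ℕ}
    (hpq : 2 * p + 2 * q = 2 * (2 * n)) (μ : HomologicalOrientation ℤ (Motives.ComplexPoints X) (2 * (2 * n)))
    {x : singularCohomology ℚ ℚ (Motives.ComplexPoints X) (2 * p)}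
    (hx : ofRatClass (Motives.ComplexPoints X) (2 * p) x ∈ algebraicClasses X p)
    (hnum : ∀ z : singularCohomology ℚ ℚ (Motives.ComplexPoints X) (2 * q),
      ofRatClass (Motives.ComplexPoints X) (2 * q) z ∈ algebraicClasses X q →
        kroneckerPairing ℚ ℚ (Motives.ComplexPoints X) (2 * (2 * n)) (cupProduct hpq x z)
          (singularHomology.coeffChange (Motives.ComplexPoints X)
            (algebraMap ℤ ℚ : ℤ →+* ℚ).toAddMonoidHom (2 * (2 * n)) μ.fundamentalClass) = 0) :
    x = 0 :=
  HodgeTheory.eq_zero_of_mem_algebraicClasses_of_forall_pairing_eq_zero_of_standardConjectureBStar_of_cupProduct_algebraicClasses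
    hX (h n hX hK) hV hpq μ hx hnum

end CharlesMarkman2013_lefschetzStandard_K3HilbertType

/-! ### `Kumⁿ`-type with `n + 1` prime (Foster 2024, Cor. 2, with Kleiman) -/

namespace Foster2024_lefschetzStandard_kummerType_prime

/-- **`D(X)` with `ℚ`-coefficients for `X` smooth projective of `Kumⁿ`-type, `n + 1` prime**
(dimension `2n`), modulo Foster's Cor. 2 (`h`) and Prop. 9.20 on `X ⊗ X` (`hcup`): for `2p + 2q = 4n`,
ANY orientation `μ`, every `x ∈ Nᵖ(X)_ℚ` with `⟨x ⌣ z, [X(ℂ)]_μ ⊗ 1_ℚ⟩ = 0` for all `z ∈ N^q(X)_ℚ` is `0`.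
[cite: Foster2024, Cor. 2 (§1.1) of Thm. 1] [cite: Murre2004LecturesMotives, §4.2.1.4 (1)] -/
theorem eq_zero_of_mem_algebraicClasses_of_forall_pairing_eq_zero
    (h : Foster2024_lefschetzStandard_kummerType_prime) (hn : (n + 1).Prime)
    (hX : IsSmoothProjective (2 * n) X) (hK : IsOfGeneralizedKummerType n X)
    (hcup : ∀ (a b : ℕ) (x : complexBetti (X ⊗ X) (2 * a)) (y : complexBetti (X ⊗ X) (2 * b)),
      x ∈ algebraicClasses (X ⊗ X) a → y ∈ algebraicClasses (X ⊗ X) b →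
        cupProduct (two_mul_add_two_mul a b) x y ∈ algebraicClasses (X ⊗ X) (a + b))
    {p q : ℕ} (hpq : 2 * p + 2 * q = 2 * (2 * n))
    (μ : HomologicalOrientation ℤ (Motives.ComplexPoints X) (2 * (2 * n)))
    {x : singularCohomology ℚ ℚ (Motives.ComplexPoints X) (2 * p)}
    (hx : ofRatClass (Motives.ComplexPoints X) (2 * p) x ∈ algebraicClasses X p)
    (hnum : ∀ z : singularCohomology ℚ ℚ (Motives.ComplexPoints X) (2 * q),
      ofRatClass (Motives.ComplexPoints X) (2 * q) z ∈ algebraicClasses X q →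
        kroneckerPairing ℚ ℚ (Motives.ComplexPoints X) (2 * (2 * n)) (cupProduct hpq x z)
          (singularHomology.coeffChange (Motives.ComplexPoints X)
            (algebraMap ℤ ℚ : ℤ →+* ℚ).toAddMonoidHom (2 * (2 * n)) μ.fundamentalClass) = 0) :
    x = 0 :=
  HodgeTheory.eq_zero_of_mem_algebraicClasses_of_forall_pairing_eq_zero_of_standardConjectureBStar hX
    (h n hn hX hK) hcup hpq μ hx hnum

/-- `D(X) ⊗ ℂ` for `Kumⁿ`-type, `n + 1` prime, modulo Foster and Prop. 9.20: a complex class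
`x ∈ Nᵖ(X)` with `⟨x ⌣ z, [X(ℂ)]_μ ⊗ 1_ℂ⟩ = 0` for all `z ∈ N^q(X)` (`2p + 2q = 4n`) is `0`.
[cite: Foster2024, Cor. 2 (§1.1)] [cite: Murre2004LecturesMotives, §4.2.1.4 (1)] -/
theorem eq_zero_of_mem_algebraicClasses_of_forall_pairing_complex_eq_zero
    (h : Foster2024_lefschetzStandard_kummerType_prime) (hn : (n + 1).Prime)
    (hX : IsSmoothProjective (2 * n) X) (hK : IsOfGeneralizedKummerType n X)
    (hcup : ∀ (a b : ℕ) (x : complexBetti (X ⊗ X) (2 * a)) (y : complexBetti (X ⊗ X) (2 * b)),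
      x ∈ algebraicClasses (X ⊗ X) a → y ∈ algebraicClasses (X ⊗ X) b →
        cupProduct (two_mul_add_two_mul a b) x y ∈ algebraicClasses (X ⊗ X) (a + b))
    {p q : ℕ} (hpq : 2 * p + 2 * q = 2 * (2 * n))
    (μ : HomologicalOrientation ℤ (Motives.ComplexPoints X) (2 * (2 * n)))
    {x : complexBetti X (2 * p)} (hx : x ∈ algebraicClasses X p)
    (hnum : ∀ z ∈ algebraicClasses X q,
      kroneckerPairing ℂ ℂ (Motives.ComplexPoints X) (2 * (2 * n)) (cupProduct hpq x z)
        (singularHomology.coeffChange (Motives.ComplexPoints X)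
          (algebraMap ℤ ℂ : ℤ →+* ℂ).toAddMonoidHom (2 * (2 * n)) μ.fundamentalClass) = 0) :
    x = 0 :=
  HodgeTheory.eq_zero_of_mem_algebraicClasses_of_forall_pairing_complex_eq_zero_of_standardConjectureBStar
    hX (h n hn hX hK) hcup hpq μ hx hnum

/-- `D(X) ⊗ ℂ` for `Kumⁿ`-type, `n + 1` prime, orientation-free. [cite: Foster2024, Cor. 2 (§1.1)] -/
theorem eq_zero_of_mem_algebraicClasses_of_forall_cupProduct_eq_zero
    (h : Foster2024_lefschetzStandard_kummerType_prime) (hn : (n + 1).Prime)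
    (hX : IsSmoothProjective (2 * n) X) (hK : IsOfGeneralizedKummerType n X)
    (hcup : ∀ (a b : ℕ) (x : complexBetti (X ⊗ X) (2 * a)) (y : complexBetti (X ⊗ X) (2 * b)),
      x ∈ algebraicClasses (X ⊗ X) a → y ∈ algebraicClasses (X ⊗ X) b →
        cupProduct (two_mul_add_two_mul a b) x y ∈ algebraicClasses (X ⊗ X) (a + b))
    {p q : ℕ} (hpq : 2 * p + 2 * q = 2 * (2 * n)) {x : complexBetti X (2 * p)}
    (hx : x ∈ algebraicClasses X p) (hcup0 : ∀ z ∈ algebraicClasses X q, cupProduct hpq x z = 0) :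
    x = 0 :=
  HodgeTheory.eq_zero_of_mem_algebraicClasses_of_forall_cupProduct_eq_zero_of_standardConjectureBStar hX
    (h n hn hX hK) hcup hpq hx hcup0

/-- For `Kumⁿ`-type, `n + 1` prime, modulo Foster and Prop. 9.20: the complex intersection pairing
`Nᵖ(X) × N^q(X) → ℂ` (`2p + 2q = 4n`, any `μ`) is non-degenerate on both sides.
[cite: Foster2024, Cor. 2 (§1.1)] [cite: Kleiman1968AlgebraicCycles, §3] -/
theorem pairing_algebraicClasses_complex_nondegenerate
    (h : Foster2024_lefschetzStandard_kummerType_prime) (hn : (n + 1).Prime)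
    (hX : IsSmoothProjective (2 * n) X) (hK : IsOfGeneralizedKummerType n X)
    (hcup : ∀ (a b : ℕ) (x : complexBetti (X ⊗ X) (2 * a)) (y : complexBetti (X ⊗ X) (2 * b)),
      x ∈ algebraicClasses (X ⊗ X) a → y ∈ algebraicClasses (X ⊗ X) b →
        cupProduct (two_mul_add_two_mul a b) x y ∈ algebraicClasses (X ⊗ X) (a + b))
    {p q : ℕ} (hpq : 2 * p + 2 * q = 2 * (2 * n))
    (μ : HomologicalOrientation ℤ (Motives.ComplexPoints X) (2 * (2 * n))) :
    (((cupProduct (R := ℂ) (X := Motives.ComplexPoints X) hpq).compr₂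
        ((kroneckerPairing ℂ ℂ (Motives.ComplexPoints X) (2 * (2 * n))).flip
          (singularHomology.coeffChange (Motives.ComplexPoints X)
            (algebraMap ℤ ℂ : ℤ →+* ℂ).toAddMonoidHom (2 * (2 * n)) μ.fundamentalClass))).domRestrict₁₂
      (algebraicClasses X p) (algebraicClasses X q)).Nondegenerate :=
  HodgeTheory.pairing_algebraicClasses_complex_nondegenerate_of_standardConjectureBStar hX (h n hn hX hK)
    hcup hpq μ

/-- For `Kumⁿ`-type, `n + 1` prime, modulo Foster and Prop. 9.20: `dim_ℂ Nᵖ(X) = dim_ℂ N^q(X)` for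
`2p + 2q = 4n`. [cite: Foster2024, Cor. 2 (§1.1)] [cite: Murre2004LecturesMotives, §4.2.1.2 Rem. 2 (b)] -/
theorem finrank_algebraicClasses_complex_eq
    (h : Foster2024_lefschetzStandard_kummerType_prime) (hn : (n + 1).Prime)
    (hX : IsSmoothProjective (2 * n) X) (hK : IsOfGeneralizedKummerType n X)
    (hcup : ∀ (a b : ℕ) (x : complexBetti (X ⊗ X) (2 * a)) (y : complexBetti (X ⊗ X) (2 * b)),
      x ∈ algebraicClasses (X ⊗ X) a → y ∈ algebraicClasses (X ⊗ X) b →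
        cupProduct (two_mul_add_two_mul a b) x y ∈ algebraicClasses (X ⊗ X) (a + b))
    {p q : ℕ} (hpq : 2 * p + 2 * q = 2 * (2 * n)) :
    Module.finrank ℂ (algebraicClasses X p) = Module.finrank ℂ (algebraicClasses X q) :=
  HodgeTheory.finrank_algebraicClasses_complex_eq_of_standardConjectureBStar hX (h n hn hX hK) hcup hpq

/-- `D(X)` with `ℚ`-coefficients for `Kumⁿ`-type, `n + 1` prime, with Prop. 9.20 in the packaged form
of the named fact `HodgeTheory.Voisin2003_cupProduct_algebraicClasses`. [cite: Foster2024, Cor. 2 (§1.1)]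
[cite: VoisinHodgeII2003, §9.2.4 Prop. 9.20] -/
theorem eq_zero_of_mem_algebraicClasses_of_forall_pairing_eq_zero_of_cupProduct_algebraicClasses
    (h : Foster2024_lefschetzStandard_kummerType_prime) (hV : Voisin2003_cupProduct_algebraicClasses)
    (hn : (n + 1).Prime) (hX : IsSmoothProjective (2 * n) X) (hK : IsOfGeneralizedKummerType n X)
    {p q : ℕ} (hpq : 2 * p + 2 * q = 2 * (2 * n))
    (μ : HomologicalOrientation ℤ (Motives.ComplexPoints X) (2 * (2 * n)))
    {x : singularCohomology ℚ ℚ (Motives.ComplexPoints X) (2 * p)}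
    (hx : ofRatClass (Motives.ComplexPoints X) (2 * p) x ∈ algebraicClasses X p)
    (hnum : ∀ z : singularCohomology ℚ ℚ (Motives.ComplexPoints X) (2 * q),
      ofRatClass (Motives.ComplexPoints X) (2 * q) z ∈ algebraicClasses X q →
        kroneckerPairing ℚ ℚ (Motives.ComplexPoints X) (2 * (2 * n)) (cupProduct hpq x z)
          (singularHomology.coeffChange (Motives.ComplexPoints X)
            (algebraMap ℤ ℚ : ℤ →+* ℚ).toAddMonoidHom (2 * (2 * n)) μ.fundamentalClass) = 0) :
    x = 0 :=
  HodgeTheory.eq_zero_of_mem_algebraicClasses_of_forall_pairing_eq_zero_of_standardConjectureBStar_of_cupProduct_algebraicClasses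
    hX (h n hn hX hK) hV hpq μ hx hnum

end Foster2024_lefschetzStandard_kummerType_prime

end Literature.AlgebraicGeometry.Hyperkaehler
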